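import Mathlib
import Summits.AnomalousDissipation.AnomalousDissipation.Theses.PointSink
import Literature.Analysis.FluidPDE.HomogeneousEuler
import Summits.AnomalousDissipation.AnomalousDissipation.Theorems.PointFluxCone.Negative.ClassicalFluxRigidityFunctionals

/-!
# Classical DSS flux rigidity — a negative lemma for the crux `PointSink.PointFluxCone`
(stmt-AnomalousDissipation-19033)

Refuter (cdisprove) record for route `AnomalousDissipation/PointSink`. The crux asks for a
discretely self-similar (DSS, ratio `λ > 1`) weak stationary Euler pair `(V, P)` on `ℝ³ ∖ {0}` of
degrees `(−2/3, −4/3)` whose radial energy-flux density `(½|V|² + P) ⟪V, x⟫/|x|²` has NON-ZERO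
integral over the fundamental shell `1 < |x| < λ`. This file proves that the natural
strengthening "the witness is `C¹` off the origin and solves steady Euler pointwise there" is
FALSE:

* `shellFlux_eq_zero_of_classical` — for `λ > 1` and `V, P ∈ C¹(ℝ³ ∖ {0})`, DSS of degrees
  `(−2/3, −4/3)` under `x ↦ λx`, with `div V = 0` and `(V·∇)V + ∇P = 0` off the origin,
  `∫_{1<|x|<λ} (½|V|² + P) ⟪V, x⟫/|x|² dx = 0`;
* `not_exists_classical_pointFluxCone` — the `¬ ∃` form (the crux's clauses with the weak
  equations replaced by the classical ones and `C¹` regularity added);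
* `shellFlux_eq_zero_of_isHomogeneousSteadyEuler` — the fully homogeneous sub-case, i.e. the
  flux part of Shvydkoy 2018, Lemma 6.1 / §6.3 ("absence of flux anomaly" for `C¹` homogeneous
  profiles of the Onsager-critical degree `−2/3`), here PROVED for the tree's class
  `Literature.Analysis.FluidPDE.IsHomogeneousSteadyEuler (2/3)` (the tree holds the sphere-moment
  form only as the named fact `shvydkoy2018_lemma61_sphereMoments`).

Consequence for provers of the crux: a witness must violate renormalised Bernoulli transport in
the bulk of every shell — it cannot be `C¹` off the origin (this file), and the same mechanism
rules out every class in which `div (h(B) V) = 0` survives (see the crux workfiles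
`Cruxes/PointFluxCone/Disproof.lean`, `BARRIER-renormalised-bernoulli-rigidity.md`).

## Proof

No sphere integrals and no moments. (1) TRANSPORT: for a pointwise steady Euler pair the head
`B = ½|V|² + P` satisfies `DB[V] = ⟪V, (V·∇)V + ∇P⟫ = 0`, so `W_c = c·arctan(B/c) V` is `C¹` and
divergence free off the origin for every level `c > 0`; multiplying by a smooth radial cut-off and
using the tree's whole-space identity `∫ θ div u + ∫ ⟪u, ∇θ⟫ = 0` gives `∫ ⟪W_c, ∇θ⟫ = 0` for
`C¹_c` tests `θ` vanishing near `0`. (2) RADIAL TESTS: for a continuous profile `ζ` supported in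
`[a, b] ⊂ (0, ∞)` and `L ≥ 1`, the kernel `(ζ(u) − ζ(u/L))/u` has a compactly supported primitive
`ρ` (both halves have the same `du/u`-mass), and `θ = ρ(|x|²)` is admissible with
`∇θ = 2ρ'(|x|²) x`; hence the level functional `N_c(ζ) = ∫ c·arctan(B/c) ⟪V,x⟫|x|⁻² ζ(|x|²) dx`
satisfies `N_c(ζ) = N_c(ζ(·/L))`. (3) SCALING: with `L = λ²` the DSS change of variables
`x = λy` gives `N_c(ζ(·/λ²)) = N_{λ^{4/3}c}(ζ)` — the powers `λ^{3 − 4/3 − 2/3 − 1}` cancel exactly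
at degree `−2/3`, and `c·arctan(λ^{-4/3}B/c) = λ^{-4/3}·(λ^{4/3}c)·arctan(B/(λ^{4/3}c))`. So
`N_c = N_{λ^{4/3}c}`. (4) LIMITS (dominated convergence, `|c·arctan(s/c)| ≤ |s|`): along
`c = λ^{-4k/3} → 0` the functional tends to `0`, along `c = λ^{4k/3} → ∞` to the flux functional
`∫ B ⟪V,x⟫|x|⁻² ζ(|x|²)`; both sequences are constant, so the flux functional vanishes for every
admissible `ζ`, and continuous clamps `ζ_n ↑ 1_{(1,λ²)}` give the shell integral.

Classification: negative lemma (refutes the `C¹` strengthening of the crux; no verdict change —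
the crux as typed allows `L²_loc × L¹_loc` convex-integration roughness). [folklore]

## Mathlib / tree search

Used from the tree: `Literature.Analysis.FluidPDE.integral_mul_divergence_add_eq_zero_left`,
`divergence_smul_apply` (`WholeSpaceIBP`), `convect`, `VectorCalculus.divergence`,
`IsHomogeneousSteadyEuler` (`HomogeneousEuler`), `ThinSetLiouville.hasDerivAt_mul_arctan_div`,
`ThinSetLiouville.abs_mul_arctan_div_le` (`NegSteadyThinSetLiouville`, the arctan-head device of
stmt-1047 on `T³`). From Mathlib: `Measure.integral_comp_smul_of_nonneg`,
`intervalIntegral.integral_comp_div`, `intervalIntegral.integral_hasDerivAt_right`,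
`hasStrictFDerivAt_norm_sq`, `Real.smoothTransition`, `tendsto_integral_of_dominated_convergence`,
`Real.le_tan`. Searched: no `arctan_le_self`/`abs_arctan_le_abs` in Mathlib (proved here), no
off-origin integration-by-parts lemma (built here from the whole-space one with a cut-off).

## References

* R. Shvydkoy, *Homogeneous solutions to the 3D Euler system*, Trans. AMS 370 (2018)
  2517–2535 = arXiv:1510.03378, Lemma 6.1 and §6.3. [`Shvydkoy2018`]

Parts 1–3 (`ClassicalFluxRigidityRadialTests`, `…Transport`, `…Functionals`) hold the radial
tests, the transport/IBP lemmas and the level functionals; this file assembles the theorem.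
-/

set_option linter.dupNamespace false  -- `Summit.AnomalousDissipation.AnomalousDissipation` is the mandated summit/problem namespace

noncomputable section

open MeasureTheory Metric Filter Topology Set Function
open scoped InnerProductSpace RealInnerProductSpace
open Literature.Analysis.FluidPDE

namespace Summit.AnomalousDissipation.AnomalousDissipation.Theorems.PointFluxCone.Negative

variable {lam : ℝ} {V : EuclideanSpace ℝ (Fin 3) → EuclideanSpace ℝ (Fin 3)}
  {P : EuclideanSpace ℝ (Fin 3) → ℝ}

/-- **Classical DSS flux rigidity** (Shvydkoy 2018 Lemma 6.1, extended from smooth fully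
homogeneous profiles to `C¹` discretely self-similar pairs, with no boundedness or moment
hypotheses). Let `λ > 1` and let `V`, `P` be `C¹` on `ℝ³ ∖ {0}`, discretely self-similar of
degrees `(−2/3, −4/3)` under `x ↦ λx`, and solve `(V·∇)V + ∇P = 0`, `div V = 0` pointwise off the
origin. Then the radial energy flux has zero log-mean over the fundamental shell:
`∫_{1<|x|<λ} (½|V|² + P) ⟪V, x⟫/|x|² dx = 0`. PROOF: Bernoulli transport `V·∇B = 0` makes
`c·arctan(B/c) V` divergence free off the origin for every level `c > 0`; testing against radial
`C¹` tests `ρ(|x|²)` whose profile is a primitive of `(ζ − ζ(·/λ²))/u` shows that the level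
functional `N_c(ζ) = ∫ c·arctan(B/c) ⟪V,x⟫|x|⁻² ζ(|x|²)` is invariant under `ζ ↦ ζ(·/λ²)`, while
the DSS change of variables turns that dilation into the level shift `c ↦ λ^{4/3} c` (all powers
of `λ` cancel exactly at degree `−2/3`); so `N_c` is constant along `c = λ^{4k/3}`, tends to the
flux functional as `c → ∞` and to `0` as `c → 0`; finally continuous clamps `ζ_n ↑ 1_{(1,λ²)}`.
[folklore] -/
theorem shellFlux_eq_zero_of_classical (hlam : 1 < lam) (hV : ContDiffOn ℝ 1 V {x | x ≠ 0})
    (hP : ContDiffOn ℝ 1 P {x | x ≠ 0})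
    (hVs : ∀ x : EuclideanSpace ℝ (Fin 3), x ≠ 0 → V (lam • x) = lam ^ (-(2 / 3 : ℝ)) • V x)
    (hPs : ∀ x : EuclideanSpace ℝ (Fin 3), x ≠ 0 → P (lam • x) = lam ^ (-(4 / 3 : ℝ)) * P x)
    (hdiv : ∀ x : EuclideanSpace ℝ (Fin 3), x ≠ 0 → VectorCalculus.divergence V x = 0)
    (hmom : ∀ x : EuclideanSpace ℝ (Fin 3), x ≠ 0 → convect V V x + gradient P x = 0) :
    ∫ x in {x : EuclideanSpace ℝ (Fin 3) | 1 < ‖x‖ ∧ ‖x‖ < lam},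
      (‖V x‖ ^ 2 / 2 + P x) * (⟪V x, x⟫ / ‖x‖ ^ 2) = 0 := by
  have hlam0 : 0 < lam := zero_lt_one.trans hlam
  set S : Set (EuclideanSpace ℝ (Fin 3)) := {x | 1 < ‖x‖ ∧ ‖x‖ < lam} with hS
  set K : Set (EuclideanSpace ℝ (Fin 3)) := {x | 1 ≤ ‖x‖ ∧ ‖x‖ ≤ lam} with hK
  set F : EuclideanSpace ℝ (Fin 3) → ℝ := fun x => (‖V x‖ ^ 2 / 2 + P x) * (⟪V x, x⟫ / ‖x‖ ^ 2)
    with hF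
  have hSm : MeasurableSet S :=
    ((isOpen_lt continuous_const continuous_norm).inter
      (isOpen_lt continuous_norm continuous_const)).measurableSet
  have hKc : IsCompact K :=
    (isCompact_closedBall (0 : EuclideanSpace ℝ (Fin 3)) lam).of_isClosed_subset
      ((isClosed_le continuous_const continuous_norm).inter
        (isClosed_le continuous_norm continuous_const))
      fun x hx => mem_closedBall_zero_iff.2 hx.2
  have hKm : MeasurableSet K := hKc.isClosed.measurableSet
  have hSK : S ⊆ K := fun x hx => ⟨hx.1.le, hx.2.le⟩
  have hK0 : K ⊆ {x : EuclideanSpace ℝ (Fin 3) | x ≠ 0} := by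
    intro x hx h0
    have := hx.1
    rw [h0, norm_zero] at this
    exact absurd this (not_le.2 one_pos)
  -- a bound for the continuous flux integrand on the closed shell
  have hFc : ContinuousOn F {x : EuclideanSpace ℝ (Fin 3) | x ≠ 0} :=
    continuousOn_fluxIntegrand hV hP
  obtain ⟨M, hM⟩ := hKc.exists_bound_of_continuousOn (hFc.mono hK0)
  set M' := max M 0 with hM'
  have hM'0 : 0 ≤ M' := le_max_right _ _
  -- continuous clamps `ζ_n ↑ 1_{(1, λ²)}`
  set ζc : ℕ → ℝ → ℝ := fun n u =>
    max 0 (min 1 (min (((n : ℝ) + 1) * (u - 1)) (((n : ℝ) + 1) * (lam ^ 2 - u)))) with hζc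
  have hζcont : ∀ n, Continuous (ζc n) := fun n =>
    continuous_const.max (continuous_const.min
      ((continuous_const.mul (continuous_id.sub continuous_const)).min
        (continuous_const.mul (continuous_const.sub continuous_id))))
  have hζ0 : ∀ n u, 0 ≤ ζc n u := fun n u => le_max_left _ _
  have hζ1 : ∀ n u, ζc n u ≤ 1 := fun n u => max_le zero_le_one (min_le_left _ _)
  have hζle : ∀ (n : ℕ) (u : ℝ), u ≤ 1 → ζc n u = 0 := fun n u hu =>
    max_eq_left ((min_le_right _ _).trans ((min_le_left _ _).trans
      (mul_nonpos_of_nonneg_of_nonpos (by positivity) (by linarith))))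
  have hζge : ∀ (n : ℕ) (u : ℝ), lam ^ 2 ≤ u → ζc n u = 0 := fun n u hu =>
    max_eq_left ((min_le_right _ _).trans ((min_le_right _ _).trans
      (mul_nonpos_of_nonneg_of_nonpos (by positivity) (by linarith))))
  have hζev : ∀ u : ℝ, 1 < u → u < lam ^ 2 → ∀ᶠ n : ℕ in atTop, ζc n u = 1 := by
    intro u h1 h2
    have hA : Tendsto (fun n : ℕ => ((n : ℝ) + 1) * (u - 1)) atTop atTop :=
      (tendsto_atTop_add_const_right _ 1 tendsto_natCast_atTop_atTop).atTop_mul_const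
        (by linarith)
    have hB : Tendsto (fun n : ℕ => ((n : ℝ) + 1) * (lam ^ 2 - u)) atTop atTop :=
      (tendsto_atTop_add_const_right _ 1 tendsto_natCast_atTop_atTop).atTop_mul_const
        (by linarith)
    filter_upwards [hA.eventually_ge_atTop 1, hB.eventually_ge_atTop 1] with n hn1 hn2
    show max 0 (min 1 (min (((n : ℝ) + 1) * (u - 1)) (((n : ℝ) + 1) * (lam ^ 2 - u)))) = 1
    rw [min_eq_left (le_min hn1 hn2), max_eq_right zero_le_one]
  -- every clamp profile is admissible, so the weighted flux integral vanishes on it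
  have hL : (1 : ℝ) ≤ lam ^ 2 := by nlinarith
  have hzero : ∀ n : ℕ, ∫ x, F x * ζc n (‖x‖ ^ 2) = 0 := fun n =>
    integral_flux_weight_eq_zero hlam hV hP hVs hPs hdiv hmom (hζcont n) one_pos hL
      (hζle n) (hζge n)
  -- dominated convergence `ζ_n(|x|²) → 1_S`
  have hlim : Tendsto (fun n : ℕ => ∫ x, F x * ζc n (‖x‖ ^ 2)) atTop
      (𝓝 (∫ x, S.indicator F x)) := by
    refine tendsto_integral_of_dominated_convergence (K.indicator fun _ => M') (fun n => ?_) ?_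
      (fun n => Eventually.of_forall fun x => ?_) (Eventually.of_forall fun x => ?_)
    · exact (continuous_mul_radial hFc (hζcont n) one_pos (hζle n)).aestronglyMeasurable
    · exact (integrable_indicator_iff hKm).2
        ((continuous_const.continuousOn).integrableOn_compact hKc)
    · by_cases hx : x ∈ S
      · rw [indicator_of_mem (hSK hx), Real.norm_eq_abs, abs_mul]
        calc |F x| * |ζc n (‖x‖ ^ 2)| ≤ M * 1 := by
              gcongr
              · exact (abs_nonneg _).trans (hM x (hSK hx))
              · exact hM x (hSK hx)
              · rw [abs_of_nonneg (hζ0 _ _)]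
                exact hζ1 _ _
          _ ≤ M' := by rw [mul_one]; exact le_max_left _ _
      · have hz : ζc n (‖x‖ ^ 2) = 0 := by
          simp only [hS, mem_setOf_eq, not_and_or, not_lt] at hx
          rcases hx with hx | hx
          · exact hζle n _ (by nlinarith [norm_nonneg x])
          · exact hζge n _ (by nlinarith)
        rw [hz, mul_zero, norm_zero]
        exact indicator_nonneg (fun _ _ => hM'0) x
    · by_cases hx : x ∈ S
      · rw [indicator_of_mem hx]
        have h1 : 1 < ‖x‖ ^ 2 := by nlinarith [hx.1]
        have h2 : ‖x‖ ^ 2 < lam ^ 2 := by nlinarith [hx.1, hx.2, norm_nonneg x]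
        refine (tendsto_const_nhds (x := F x)).congr' ?_
        filter_upwards [hζev _ h1 h2] with n hn
        rw [hn, mul_one]
      · rw [indicator_of_notMem hx]
        have hz : ∀ n : ℕ, ζc n (‖x‖ ^ 2) = 0 := fun n => by
          simp only [hS, mem_setOf_eq, not_and_or, not_lt] at hx
          rcases hx with hx | hx
          · exact hζle n _ (by nlinarith [norm_nonneg x])
          · exact hζge n _ (by nlinarith)
        simp only [hz, mul_zero]
        exact tendsto_const_nhds
  rw [integral_indicator hSm] at hlim
  have hconst : (fun n : ℕ => ∫ x, F x * ζc n (‖x‖ ^ 2)) = fun _ => 0 := funext hzero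
  rw [hconst] at hlim
  exact (tendsto_const_nhds_iff.1 hlim).symm

/-- **No classical witness of `PointFluxCone`** (the crux strengthened by `C¹` regularity is
FALSE): there is no `λ > 1` and no pair `(V, P)`, `C¹` on `ℝ³ ∖ {0}`, discretely self-similar of
degrees `(−2/3, −4/3)`, solving steady Euler pointwise off the origin, with non-zero flux
log-mean. Hence every witness of the crux is NOT `C¹` off the origin — more precisely it must
violate renormalised Bernoulli transport in the bulk of every shell. [folklore] -/
theorem not_exists_classical_pointFluxCone :
    ¬ ∃ (lam : ℝ) (V : EuclideanSpace ℝ (Fin 3) → EuclideanSpace ℝ (Fin 3))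
        (P : EuclideanSpace ℝ (Fin 3) → ℝ), 1 < lam ∧
      ContDiffOn ℝ 1 V {x : EuclideanSpace ℝ (Fin 3) | x ≠ 0} ∧
      ContDiffOn ℝ 1 P {x : EuclideanSpace ℝ (Fin 3) | x ≠ 0} ∧
      (∀ x : EuclideanSpace ℝ (Fin 3), x ≠ 0 → V (lam • x) = lam ^ (-(2 / 3 : ℝ)) • V x) ∧
      (∀ x : EuclideanSpace ℝ (Fin 3), x ≠ 0 → P (lam • x) = lam ^ (-(4 / 3 : ℝ)) * P x) ∧
      (∀ x : EuclideanSpace ℝ (Fin 3), x ≠ 0 → VectorCalculus.divergence V x = 0) ∧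
      (∀ x : EuclideanSpace ℝ (Fin 3), x ≠ 0 → convect V V x + gradient P x = 0) ∧
      (∫ x in {x : EuclideanSpace ℝ (Fin 3) | 1 < ‖x‖ ∧ ‖x‖ < lam},
        (‖V x‖ ^ 2 / 2 + P x) * (⟪V x, x⟫ / ‖x‖ ^ 2)) ≠ 0 := by
  rintro ⟨lam, V, P, hlam, hV, hP, hVs, hPs, hdiv, hmom, hne⟩
  exact hne (shellFlux_eq_zero_of_classical hlam hV hP hVs hPs hdiv hmom)

/-- **Shvydkoy 2018, Lemma 6.1 (flux part), bulk form, PROVED for `C¹` profiles**: a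
homogeneous (under all dilations) `C¹` steady Euler pair of degree `−2/3` on `ℝ³ ∖ {0}` — the
tree's class `IsHomogeneousSteadyEuler (2/3)` — has zero flux log-mean on every shell
`1 < |x| < λ`. [cite: Shvydkoy2018, Lemma 6.1 / §6.3] -/
theorem shellFlux_eq_zero_of_isHomogeneousSteadyEuler (h : IsHomogeneousSteadyEuler (2 / 3) V P)
    (hlam : 1 < lam) :
    ∫ x in {x : EuclideanSpace ℝ (Fin 3) | 1 < ‖x‖ ∧ ‖x‖ < lam},
      (‖V x‖ ^ 2 / 2 + P x) * (⟪V x, x⟫ / ‖x‖ ^ 2) = 0 := by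
  have hlam0 : 0 < lam := zero_lt_one.trans hlam
  refine shellFlux_eq_zero_of_classical hlam h.contDiffOn_velocity h.contDiffOn_pressure
    (fun x hx => h.velocity_smul hlam0 hx) (fun x hx => ?_) (fun x hx => h.divergence_eq_zero hx)
    (fun x hx => h.momentum hx)
  rw [h.pressure_smul hlam0 hx]
  norm_num

end Summit.AnomalousDissipation.AnomalousDissipation.Theorems.PointFluxCone.Negative

end
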